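import Summits.Ventures.HodgeRepro2.T6N41PlaceKappaToy

/-!
# T6N41PlaceUniv — the placement chain over ANY N4.1 datum whose `S` is all places (README §10.5(ii)(c)/(d); owner t6-p4)

The lead's v7 plan (STATUS l. 11672) replaces, per side, the residual `hunr` of `periodInputN_of_published₆` by
the placement (P7) data `Pl In Sp LQ Kd`, its SEVEN displays, the dichotomy `hdich` and the residual `hκ'`
(T6PeriodInput6PlacedTau.staged.lean); the §10.5(ii)(d) witness of that binder set is t6-p6's joint toy, whose
N4 sides carry t6-p5's `toyD41`, a datum with `S = Finset.univ`.  The placement toys of this lane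
(T6N41PlaceToy / PlaceInertToy / PlaceSplitToy / PlaceKappaToy) live over the lane's OWN datums, so on the joint
toy the placement slots had no theorem (t6-p6's ask, STATUS l. 11830 (3)).

This file gives the PARAMETRISED chain: for EVERY `D : DoublingLDatum ι` with `hS : ∀ v, v ∈ D.S` (in
particular `D.S = Finset.univ`, `forall_mem_S_of_eq_univ`) the five carriers `univPl D hS`, `univIn D hS`,
`univSp D hS`, `univLQ D hS`, `univKd D hS` and, as THEOREMS, the seven displays, the dichotomy and `hκ'`,
composed through `N41Place.N41_placement_kappa` into `univ_placement_kappa`.  The model: one prime per place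
(`κ = ι`, `b = id`, norm `2`), every place inert (`inert ≡ True`, no split place), a representation of
`GL₂(E_𝔓)` / of `U(W_v)` is its Satake pair (`ℂˣ × ℂˣ`, `ps = psF = Prod.mk`), `π_v = (−1, (−1)⁻¹)` = the
constituent of `I(χ′/χ)` with `(χ′/χ)(ϖ) = −1`, Rogawski's lift the identity on pairs (`JH 𝔓 a = {(a, a⁻¹)}`),
`χ_V(ϖ) = γ_D(ϖ) = −1`, `ω̃ = 1`, so that `BC(π_v) ⊗ χ_V = (1, 1) = (η₁′(𝔓), η₂′(𝔓))` — the forcing read-back of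
(P7) at an inert place holds on the model; the split carriers are the IS toy's (`θII β = (1, β⁻¹)`,
`LQ a b = (a, b)`, `μ₁ = μ₂ = 1`), the convention datum is the real place's square classes of the κ toy
(`hilbert a c = sgn (a ∧ c)`, `γF a η = sgn (a ∧ η)`, `ϖ = t = true`, `ψ = false`, `λ = κ_v = −1`).

What is vacuous and what is not: the clauses guarded by «`v ∉ S`» (Lapid–Rallis §7, Harris II (2.2.5)(b),
`hdich`, `hκ'`, the placement conclusion itself) are vacuous on such a `D` — that is the point of the ask —
but every field and display that is NOT so guarded is proved by computation on the model (Bump (5.22),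
Rogawski §11.4, Mínguez Thm 1 (2), Bump Thm 4.5.1, Rao Cor. A.5 (1), `twist_ps`, `ps_inj`, `twistF_ps`,
`ωc_ps`, `ι₁_ps`, `ι₂_ps`, `Θ_eq`, `ωt_eq`), Harris II and the inert fields `η₁_def` / `η₂_def` / `BCχ_eq` are
proved by computation as well (not by the guard), and the residual identity `hκ'` holds on the model
unguarded (`univ_kappa'_value`).  No display is closed by `trivial` / `simp` / `decide` / `exact ⟨⟩` on a
general datum.

§8(d): uses an L-value-free non-vanishing device: NO.
-/

namespace Summit.Ventures.HodgeRepro2.T6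
namespace N41PlaceUniv

open N41PlaceToy (sgn sgn_and_xor sgn_true sgn_false)

variable {ι : Type}

/-- `D.S = Finset.univ` gives «every place is in `S`», the hypothesis the chain takes. -/
theorem forall_mem_S_of_eq_univ [Fintype ι] (D : DoublingLDatum ι) (hS : D.S = Finset.univ) :
    ∀ v, v ∈ D.S := fun v => hS ▸ Finset.mem_univ v

/-- The fibre of `b = id` above `v` is finite (it is `{v}`). -/
theorem univFin (v : ι) : (id ⁻¹' {v} : Set ι).Finite := by
  simp

/-- The fibre above `v`, as a `Finset`, is `{v}`. -/
theorem univFin_toFinset (v : ι) : (univFin v).toFinset = {v} := by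
  ext x
  simp

/-- The placement datum over `D`: one prime per place (`κ = ι`, `b = id`) of norm `2`; a representation of
`GL₂(E_𝔓)` is its Satake pair (`RepGL = ℂˣ × ℂˣ`, `ps = Prod.mk`), `LGL` = Bump's (5.22) on the pair;
`BCχ = (1, 1)`, `α = β = 1`; `η₁ = η₂ = 1`; `LGLv` the fibre product by definition.  `BCχ_ps` holds by
`rfl`; `g₁_eq` / `g₂_eq` are vacuous (`v ∉ S` is impossible). -/
@[reducible] noncomputable def univPl (D : DoublingLDatum ι) (hS : ∀ v, v ∈ D.S) : PlacementDatum D where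
  κ := ι
  b := id
  fin := univFin
  N := fun _ => 2
  one_lt_N := fun _ => by norm_num
  RepGL := fun _ => ℂˣ × ℂˣ
  ps := fun _ a b => (a, b)
  LGL := fun _ p s => (1 - (p.1 : ℂ) * (2 : ℂ) ^ (-s))⁻¹ * (1 - (p.2 : ℂ) * (2 : ℂ) ^ (-s))⁻¹
  BCχ := fun _ => (1, 1)
  LGLv := fun v s => ∏ _𝔓 ∈ (univFin v).toFinset,
    (1 - ((1 : ℂˣ) : ℂ) * (2 : ℂ) ^ (-s))⁻¹ * (1 - ((1 : ℂˣ) : ℂ) * (2 : ℂ) ^ (-s))⁻¹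
  LGLv_eq := fun _ => rfl
  α := fun _ => 1
  β := fun _ => 1
  BCχ_ps := fun _ _ => rfl
  η₁ := fun _ => 1
  η₂ := fun _ => 1
  g₁_eq := fun v hv => (hv (hS v)).elim
  g₂_eq := fun v hv => (hv (hS v)).elim

/-- The inert datum over `univPl D hS`: every prime inert; `RepU = ℂˣ × ℂˣ`; `π_v = (−1, (−1)⁻¹)`, the
constituent `JH 𝔓 a = {(a, a⁻¹)}` of `I(χ)` with `χ(ϖ) = a`; Rogawski's lift the identity on pairs; the twist
componentwise; `χ′/χ = χ_V = γ_D = −1`, `ω̃ = 1` at `ϖ`; `βTrivial`, `thetaLift` true.  Every elementary /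
definitional / compat field is PROVED on the model (`η₂ = 1 = (−1)(−1)`, `η₁ = 1 = 1 · (−1)⁻¹ · (−1)`,
`BCχ = (1, 1) = twist (−1, (−1)⁻¹) (−1)`), none by the `v ∉ S` guard. -/
@[reducible] noncomputable def univIn (D : DoublingLDatum ι) (hS : ∀ v, v ∈ D.S) : InertDatum (univPl D hS) where
  inert := fun _ => True
  RepU := fun _ => ℂˣ × ℂˣ
  π := fun _ => (-1, (-1)⁻¹)
  JH := fun _ a => {ρ | ρ = (a, a⁻¹)}
  BCrog := fun _ ρ => ρ
  twist := fun _ p ξ => (p.1 * ξ, p.2 * ξ)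
  twist_ps := fun _ _ _ _ => rfl
  ps_inj := fun _ a b c d h => Or.inl ⟨congrArg Prod.fst h, congrArg Prod.snd h⟩
  χHarris := fun _ => -1
  ξV := fun _ => -1
  γD := fun _ => -1
  ωt := fun _ => 1
  βTrivial := fun _ => True
  thetaLift := fun _ => True
  thetaLift_all := fun _ => trivial
  βTrivial_of := fun _ _ _ => trivial
  χHarris_eq := fun _ _ _ => rfl
  ξV_eq := fun _ _ _ => rfl
  γD_eq := fun _ _ _ => rfl
  ωt_eq := fun _ _ => rfl
  η₂_def := fun _ _ _ => by simp
  η₁_def := fun _ _ _ => by simp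
  BCχ_eq := fun _ _ _ => by simp [univPl]

/-- The split datum over `univIn D hS`: NO split place (`splitPlace ≡ False`), so every `splitPlace`-guarded
field is vacuous; the unguarded carriers are the IS toy's (`psF = Prod.mk`, `twistF` componentwise, `ωc` the
product, `θII β = (1, β⁻¹)`, `Θ` = the twist rule evaluated, `μ₁ = μ₂ = 1`, `ι₁ = id`, `ι₂` the componentwise
inverse) and their elementary fields are PROVED (`twistF_ps`, `ωc_ps`, `Θ_eq`, `ι₁_ps`, `ι₂_ps` by `rfl`). -/
@[reducible] noncomputable def univSp (D : DoublingLDatum ι) (hS : ∀ v, v ∈ D.S) : SplitDatum (univIn D hS) where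
  splitPlace := fun _ => False
  p₁ := id
  p₂ := id
  b_p₁ := fun _ h => h.elim
  b_p₂ := fun _ h => h.elim
  p₁_ne_p₂ := fun _ h => h.elim
  fiber_split := fun _ h => h.elim
  not_inert := fun _ h => h.elim
  psF := fun _ a b => (a, b)
  twistF := fun _ p ξ => (p.1 * ξ, p.2 * ξ)
  twistF_ps := fun _ _ _ _ => rfl
  ωc := fun _ p => p.1 * p.2
  ωc_ps := fun _ _ _ => rfl
  θII := fun _ β => (1, β⁻¹)
  Θ := fun _ β => ((1 : ℂˣ) * 1, (β * (1 : ℂˣ)⁻¹)⁻¹ * 1)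
  βv := fun _ => 1
  βv_unit := fun _ h => h.elim
  π_Θ := fun _ h => h.elim
  μ₁ := fun _ => 1
  μ₂ := fun _ => 1
  μ₁_unit := fun _ h => h.elim
  Θ_eq := fun _ _ _ _ => rfl
  ι₁ := fun _ p => p
  ι₂ := fun _ p => (p.1⁻¹, p.2⁻¹)
  ι₁_ps := fun _ _ _ => rfl
  ι₂_ps := fun _ _ _ => rfl
  BCχ_p₁ := fun _ h => h.elim
  BCχ_p₂ := fun _ h => h.elim
  ωt_p₁ := fun _ h => h.elim
  ωt_p₂ := fun _ h => h.elim
  γD_p₂ := fun _ h => h.elim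
  η₂_def := fun _ h => h.elim
  η₁_def := fun _ h => h.elim

/-- The Langlands-quotient carrier over `univSp D hS`: `LQ a b = (a, b)` (every principal series of the model is
its own Langlands quotient). -/
@[reducible] noncomputable def univLQ (D : DoublingLDatum ι) (hS : ∀ v, v ∈ D.S) : SplitLQ (univSp D hS) where
  LQ := fun _ a b => (a, b)

/-- The convention-character datum over `univSp D hS`: the real place's square classes as Booleans (the κ toy's
model — `hilbert a c = sgn (a ∧ c)`, `γF a η = sgn (a ∧ η)`, `ϖ = t = true`, `ψ = false`, `λ = κ_v = −1`); the
two `splitPlace`-guarded fields are vacuous. -/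
@[reducible] noncomputable def univKd (D : DoublingLDatum ι) (hS : ∀ v, v ∈ D.S) : KappaDatum (univSp D hS) where
  Fx := fun _ => Bool
  AddCh := fun _ => Bool
  smul := fun _ c η => xor c η
  hilbert := fun _ a c => sgn (a && c)
  γF := fun _ a η => sgn (a && η)
  ϖ := fun _ => true
  ψ := fun _ => false
  t := fun _ => true
  lam := fun _ => -1
  κv := fun _ => -1
  μ₂_eq := fun _ h => h.elim
  γD_def := fun _ h => h.elim

/-! ### The seven displays, the dichotomy and the residual, as theorems on the chain -/

section displays

variable (D : DoublingLDatum ι) (hS : ∀ v, v ∈ D.S)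

/-- Lapid–Rallis §7 on the chain: vacuous (`v ∉ S` is impossible) — necessarily so, `D.Lv` is arbitrary. -/
theorem univ_LR7 : Hyp.LapidRallis2005_Sec7_Unramified D (univPl D hS) :=
  fun v hv => (hv (hS v)).elim

/-- Bump (5.22) on the chain, by construction of `LGL` (not vacuous: every `𝔓`, every `(α₁, α₂)`). -/
theorem univ_Bump : Hyp.Bump1997_5_22 (univPl D hS) := fun _ _ _ => rfl

/-- Harris II (2.2.5)(b) on the chain, by computation: `π_v = (−1, (−1)⁻¹) ∈ JH 𝔓 (−1) = {(−1, (−1)⁻¹)}`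
(the `v ∉ S` guard is not used). -/
theorem univ_Harris : Hyp.HarrisII2007_Prop2_2_5_b (univIn D hS) := by
  intro 𝔓 _ _ _ _
  simp [univIn, univPl]

/-- Rogawski §11.4 on the chain, by computation (not vacuous: every `𝔓`, every unitary `a`): the lift of the
member `ρ = (a, a⁻¹)` of `JH 𝔓 a` is `ρ = ps 𝔓 a a⁻¹`. -/
theorem univ_Rogawski : Hyp.Rogawski1990_Sec11_4_BC (univIn D hS) := by
  intro 𝔓 _ a _ ρ hρ
  change ρ = (a, a⁻¹) at hρ
  change ρ = (a, a⁻¹)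
  exact hρ

/-- Mínguez Thm 1 (2) on the chain, by construction: `θII β = (1, β⁻¹) = LQ 1 β⁻¹` (the guard is not used). -/
theorem univ_Minguez : Hyp.Minguez2008_Thm1_2_LQ (univLQ D hS) := fun _ _ _ => rfl

/-- Bump Thm 4.5.1 on the chain, by construction: `LQ a b = (a, b) = psF a b` (the guards are not used). -/
theorem univ_Bump451 : Hyp.Bump1997_Thm4_5_1 (univLQ D hS) := fun _ _ _ _ _ _ => rfl

/-- Rao Cor. A.5 (1) on the chain, by the Boolean case analysis `sgn (a ∧ (c ⊕ η)) = sgn (a ∧ c) · sgn (a ∧ η)`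
(not vacuous: every `v`, every `a, c, η`). -/
theorem univ_Rao : Hyp.Rao1993_CorA5_1 (univKd D hS) := fun _ a c η => sgn_and_xor a c η

/-- The dichotomy on the chain: every prime is inert. -/
theorem univ_dich : ∀ 𝔓, (univPl D hS).b 𝔓 ∉ D.S → (univIn D hS).inert 𝔓 ∨ (univSp D hS).splitPlace ((univPl D hS).b 𝔓) :=
  fun _ _ => Or.inl trivial

/-- The residual identity `κ_v(ϖ_v) = κ′(ϖ_v)⁻¹` holds on the model at EVERY place, unguarded:
`−1 = (sgn (true ∧ false) · (sgn (true ∧ (true ⊕ false)))⁻¹)⁻¹ = (1 · (−1)⁻¹)⁻¹`. -/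
theorem univ_kappa'_value (v : ι) : (univKd D hS).κv v = ((univKd D hS).κ' v)⁻¹ := by
  show (-1 : ℂˣ) = (sgn (true && false) * (sgn (true && xor true false))⁻¹)⁻¹
  simp [sgn_true, sgn_false]

/-- The residual `hκ'` of `N41_placement_kappa` on the chain (from `univ_kappa'_value`; the guards are not used). -/
theorem univ_kappa' : ∀ v, (univSp D hS).splitPlace v → v ∉ D.S → (univKd D hS).κv v = ((univKd D hS).κ' v)⁻¹ :=
  fun v _ _ => univ_kappa'_value D hS v

include hS in
/-- **The placement (P7) composed on the chain:** the hypotheses of `N41_placement_kappa` hold jointly on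
`univPl D hS` … `univKd D hS` — the seven displays, the dichotomy, the residual — and its conclusion (the
unramified identity, vacuous on such a `D`) is obtained by applying the theorem. -/
theorem univ_placement_kappa : ∀ v ∉ D.S, ∀ s : ℂ, D.Lv v s = D.g₁ v s * D.g₂ v s :=
  N41Place.N41_placement_kappa D (univPl D hS) (univIn D hS) (univSp D hS) (univLQ D hS) (univKd D hS)
    (univ_LR7 D hS) (univ_Bump D hS) (univ_Harris D hS) (univ_Rogawski D hS) (univ_Minguez D hS)
    (univ_Bump451 D hS) (univ_Rao D hS) (univ_dich D hS) (univ_kappa' D hS)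

end displays

end N41PlaceUniv
end Summit.Ventures.HodgeRepro2.T6
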